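import Mathlib
import Literature.Computability.AlgebraicComplexity.GroupTheoreticMatMul
import Summits.MatrixMultiplication.MatrixMultiplication.Theorems.ThinPackings.Negative.TriageRuledGraphPatternedArc

/-!
# drefute — the GENERAL bridge behind `stub_gradedFrames` (sharpening for the lead / planner)

Crux `ThinPackings` (stmt-MatrixMultiplication-10595), line `label-weighted-stpp-debordering`.
`generalFramesWeighted`: for an orthogonal frame family whose legs lie on spheres of ARBITRARY block radii
`rA i, rB i, rC i` and ARBITRARY integer potentials `κ, μ`, the only thing the Pythagoras argument needs is
ORDER-COMPATIBILITY of the potentials with the three mixed radii: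
  (T) `rA i + rC i < rA k + rC k → 1 ≤ (κ i + μ i) − (κ k + μ k)`   (tile radius up ⇒ κ+μ down),
  (E) `rA j + rB j < rA i + rB i → 1 ≤ κ i − κ j`                   (κ increasing in the E-radius),
  (F) `rB i + rC i < rB j + rC j → 1 ≤ μ j − μ i`                   (μ increasing in the F-radius);
then `IsLabelWeightedSTPP A B C κ μ ↔` the three packings `∧` the distinct clause restricted to the triples of
weight `(κ i − κ k) + (μ j − μ k) ≤ 0`.  The registered `stub_gradedFrames` is the one-parameter corollary
`(rA, rB, rC) = (xA + αd, xB − βd, xC + γd)`, `κ = μ = −d` (re-derived below as `gradedFramesWeighted'`); a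
genuinely TWO-parameter instance for the model slopes `(1,2,1)` is `(xA + g + h, xB − 2g, xC + g − h)` with
`κ = h − g`, `μ = −g − h` (same `g`, different `h`: same tile sphere, different A/C split) — a strictly larger
design space for `stub_multiRadiusFrames` at no cost in the tools.
Refuter seat refuter-drefute-stmt-MatrixMultiplication-10595-0, 2026-08-16 (positive lemmas; candidates for the
lead, not landed by the refuter).
-/

set_option linter.dupNamespace false

namespace Summit.MatrixMultiplication.MatrixMultiplication.Cruxes.ThinPackings.DrefuteGeneral

open Matrix
open Summit.MatrixMultiplication.MatrixMultiplication.Theorems.ThinPackings.Negative.Triage2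
  (IsLabelWeightedSTPP)

/-! ## Norm-square helpers over `ℤ^D` -/

section Helpers

variable {D : ℕ}

theorem dp_self_nonneg (v : Fin D → ℤ) : 0 ≤ v ⬝ᵥ v :=
  Finset.sum_nonneg fun i _ => mul_self_nonneg (v i)

theorem one_le_dp_self_of_ne_zero {v : Fin D → ℤ} (hv : v ≠ 0) : 1 ≤ v ⬝ᵥ v := by
  have h0 : 0 ≤ v ⬝ᵥ v := dp_self_nonneg v
  have hne : v ⬝ᵥ v ≠ 0 := fun h => hv (dotProduct_self_eq_zero.1 h)
  omega

theorem normsq_add (x y : Fin D → ℤ) :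
    (x + y) ⬝ᵥ (x + y) = x ⬝ᵥ x + y ⬝ᵥ y + 2 * (x ⬝ᵥ y) := by
  simp only [add_dotProduct, dotProduct_add, dotProduct_comm y x]; ring

theorem normsq_sub (x y : Fin D → ℤ) :
    (x - y) ⬝ᵥ (x - y) = x ⬝ᵥ x + y ⬝ᵥ y - 2 * (x ⬝ᵥ y) := by
  simp only [sub_dotProduct, dotProduct_sub, dotProduct_comm y x]; ring

theorem normsq_add_three (x y z : Fin D → ℤ) :
    (x + y + z) ⬝ᵥ (x + y + z) =
      x ⬝ᵥ x + y ⬝ᵥ y + z ⬝ᵥ z + 2 * (x ⬝ᵥ y) + 2 * (x ⬝ᵥ z) + 2 * (y ⬝ᵥ z) := by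
  simp only [add_dotProduct, dotProduct_add, dotProduct_comm y x, dotProduct_comm z x,
    dotProduct_comm z y]
  ring

/-- dot product of two differences, expanded. -/
theorem sub_dp_sub (p q r w : Fin D → ℤ) :
    (p - q) ⬝ᵥ (r - w) = p ⬝ᵥ r - p ⬝ᵥ w - q ⬝ᵥ r + q ⬝ᵥ w := by
  simp only [sub_dotProduct, dotProduct_sub]; ring

/-- Three pairwise-orthogonal integer vectors summing to zero all vanish. -/
theorem eq_zero_of_orth_sum_zero {x y z : Fin D → ℤ} (hxy : x ⬝ᵥ y = 0) (hxz : x ⬝ᵥ z = 0)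
    (hyz : y ⬝ᵥ z = 0) (h : x + y + z = 0) : x = 0 ∧ y = 0 ∧ z = 0 := by
  have hsum : x ⬝ᵥ x + y ⬝ᵥ y + z ⬝ᵥ z = 0 := by
    have := normsq_add_three x y z
    rw [h, hxy, hxz, hyz] at this
    simp at this
    linarith
  have hx := dp_self_nonneg x
  have hy := dp_self_nonneg y
  have hz := dp_self_nonneg z
  refine ⟨dotProduct_self_eq_zero.1 (by omega), dotProduct_self_eq_zero.1 (by omega),
    dotProduct_self_eq_zero.1 (by omega)⟩

end Helpers

/-! ## The general bridge -/

/-- Swapping the sides of a difference equation in an additive group. -/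
theorem sub_eq_sub_swap {G : Type*} [AddCommGroup G] {a b a' b' : G} (h : a - b = a' - b') :
    b - a = b' - a' := by
  rw [← neg_sub a b, ← neg_sub a' b', h]

/-- **General order-compatible bridge.**  Frames on spheres of arbitrary block radii with order-compatible
integer potentials are label-weighted iff the three packings hold and the non-positive-weight distinct triples
carry no relation. [new, elementary] -/
theorem generalFramesWeighted (D L : ℕ) (A B C : Fin L → Finset (Fin D → ℤ))
    (rA rB rC κ μ : Fin L → ℤ)
    (hfr : (∀ i, ∀ x ∈ A i, ∀ y ∈ B i, x ⬝ᵥ y = 0) ∧ (∀ i, ∀ x ∈ A i, ∀ z ∈ C i, x ⬝ᵥ z = 0) ∧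
      (∀ i, ∀ y ∈ B i, ∀ z ∈ C i, y ⬝ᵥ z = 0))
    (hsph : (∀ i, ∀ x ∈ A i, x ⬝ᵥ x = rA i) ∧ (∀ i, ∀ y ∈ B i, y ⬝ᵥ y = rB i) ∧
      (∀ i, ∀ z ∈ C i, z ⬝ᵥ z = rC i))
    (hT : ∀ i k, rA i + rC i < rA k + rC k → 1 ≤ (κ i + μ i) - (κ k + μ k))
    (hE : ∀ i j, rA j + rB j < rA i + rB i → 1 ≤ κ i - κ j)
    (hF : ∀ i j, rB i + rC i < rB j + rC j → 1 ≤ μ j - μ i) :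
    (IsLabelWeightedSTPP A B C κ μ ↔
      ((∀ i k, ∀ a ∈ A i, ∀ c ∈ C i, ∀ a' ∈ A k, ∀ c' ∈ C k, c - a = c' - a' → i = k ∧ a = a' ∧ c = c') ∧
       (∀ i k, ∀ a ∈ A i, ∀ b ∈ B i, ∀ a' ∈ A k, ∀ b' ∈ B k, b - a = b' - a' → i = k ∧ a = a' ∧ b = b') ∧
       (∀ i k, ∀ b ∈ B i, ∀ c ∈ C i, ∀ b' ∈ B k, ∀ c' ∈ C k, b - c = b' - c' → i = k ∧ b = b' ∧ c = c') ∧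
       (∀ i j k : Fin L, i ≠ j → j ≠ k → i ≠ k → (κ i - κ k) + (μ j - μ k) ≤ 0 →
          ∀ s ∈ A k, ∀ s' ∈ A i, ∀ t ∈ B i, ∀ t' ∈ B j, ∀ u ∈ C j, ∀ u' ∈ C k,
            (s' - s) + (t' - t) + (u' - u) ≠ 0))) := by
  obtain ⟨hAB, hAC, hBC⟩ := hfr
  obtain ⟨hA, hB, hC⟩ := hsph
  constructor
  · -- `→`: read off clauses (1)–(3) and (5)
    rintro ⟨h1, h2, h3, -, h5⟩
    refine ⟨?_, ?_, ?_, ?_⟩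
    · intro i k a ha c hc a' ha' c' hc' he
      obtain ⟨hik, hcc, haa⟩ := h3 i k c hc a ha c' hc' a' ha' he
      exact ⟨hik, haa, hcc⟩
    · intro i k a ha b hb a' ha' b' hb' he
      obtain ⟨hik, haa, hbb⟩ := h1 i k a ha b hb a' ha' b' hb' (sub_eq_sub_swap he)
      exact ⟨hik, haa, hbb⟩
    · intro i k b hb c hc b' hb' c' hc' he
      exact h2 i k b hb c hc b' hb' c' hc' he
    · intro i j k hij hjk hik hw0 s hs s' hs' t ht t' ht' u hu u' hu' h0
      have hne : ¬ (i = j ∧ j = k) := fun h => hij h.1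
      have hw := h5 i j k hne s hs s' hs' t ht t' ht' u hu u' hu' h0
      omega
  · -- `←`: packings + restricted distinct clause + geometry give the weighted family
    rintro ⟨r1, r2, r3, r4⟩
    refine ⟨?_, ?_, ?_, ?_, ?_⟩
    · intro i k s hs t ht s' hs' t' ht' he
      obtain ⟨hik, hss, htt⟩ := r2 i k s hs t ht s' hs' t' ht' (sub_eq_sub_swap he)
      exact ⟨hik, hss, htt⟩
    · intro j k t ht u hu t' ht' u' hu' he
      exact r3 j k t ht u hu t' ht' u' hu' he
    · intro i k u hu s hs u' hu' s' hs' he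
      obtain ⟨hik, hss, huu⟩ := r1 i k s hs u hu s' hs' u' hu' he
      exact ⟨hik, huu, hss⟩
    · -- (4) TPP of each block, by Pythagoras
      intro i s hs s' hs' t ht t' ht' u hu u' hu' h0
      have hxy : (s' - s) ⬝ᵥ (t' - t) = 0 := by
        rw [sub_dp_sub, hAB i s' hs' t' ht', hAB i s' hs' t ht, hAB i s hs t' ht', hAB i s hs t ht]
        ring
      have hxz : (s' - s) ⬝ᵥ (u' - u) = 0 := by
        rw [sub_dp_sub, hAC i s' hs' u' hu', hAC i s' hs' u hu, hAC i s hs u' hu', hAC i s hs u hu]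
        ring
      have hyz : (t' - t) ⬝ᵥ (u' - u) = 0 := by
        rw [sub_dp_sub, hBC i t' ht' u' hu', hBC i t' ht' u hu, hBC i t ht u' hu', hBC i t ht u hu]
        ring
      obtain ⟨hx, hy, hz⟩ := eq_zero_of_orth_sum_zero hxy hxz hyz h0
      exact ⟨(sub_eq_zero.1 hx).symm, (sub_eq_zero.1 hy).symm, (sub_eq_zero.1 hz).symm⟩
    · -- (5) cross relations: four label patterns
      intro i j k hne s hs s' hs' t ht t' ht' u hu u' hu' h0
      by_cases hij : i = j
      · subst hij
        -- pattern (i, i, k), i ≠ k :  rT k − rT i = ‖t' − t‖²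
        have hik : i ≠ k := fun h => hne ⟨rfl, h⟩
        have hdec : s - u' = (s' - u) + (t' - t) := by
          have key : (s' - u) + (t' - t) - (s - u') = 0 := by rw [← h0]; abel
          exact (sub_eq_zero.1 key).symm
        have horth : (s' - u) ⬝ᵥ (t' - t) = 0 := by
          rw [sub_dp_sub, hAB i s' hs' t' ht', hAB i s' hs' t ht, dotProduct_comm u t',
            hBC i t' ht' u hu, dotProduct_comm u t, hBC i t ht u hu]
          ring
        have hL : (s - u') ⬝ᵥ (s - u') = rA k + rC k := by
          rw [normsq_sub, hA k s hs, hC k u' hu', hAC k s hs u' hu']; ring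
        have hR : ((s' - u) + (t' - t)) ⬝ᵥ ((s' - u) + (t' - t)) =
            rA i + rC i + (t' - t) ⬝ᵥ (t' - t) := by
          rw [normsq_add, horth, normsq_sub s' u, hA i s' hs', hC i u hu, hAC i s' hs' u hu]; ring
        have heq : rA k + rC k = rA i + rC i + (t' - t) ⬝ᵥ (t' - t) := by
          have := hL; rw [hdec, hR] at this; linarith
        have htt : t' - t ≠ 0 := by
          intro hz
          have htt' : t' = t := sub_eq_zero.1 hz
          have hrel : u - s' = u' - s := by
            have key : (u' - s) - (u - s') = 0 := by
              rw [← h0, htt', sub_self, add_zero]; abel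
            exact (sub_eq_zero.1 key).symm
          exact hik (r1 i k s' hs' u hu s hs u' hu' hrel).1
        have h1 := one_le_dp_self_of_ne_zero htt
        have hw := hT i k (by omega)
        omega
      · by_cases hjk : j = k
        · subst hjk
          -- pattern (i, j, j), i ≠ j :  rE i − rE j = ‖u − u'‖²
          have hdec : s' - t = (s - t') + (u - u') := by
            have key : (s' - t) - ((s - t') + (u - u')) = 0 := by rw [← h0]; abel
            exact sub_eq_zero.1 key
          have horth : (s - t') ⬝ᵥ (u - u') = 0 := by
            rw [sub_dp_sub, hAC j s hs u hu, hAC j s hs u' hu', hBC j t' ht' u hu,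
              hBC j t' ht' u' hu']
            ring
          have hL : (s' - t) ⬝ᵥ (s' - t) = rA i + rB i := by
            rw [normsq_sub, hA i s' hs', hB i t ht, hAB i s' hs' t ht]; ring
          have hR : ((s - t') + (u - u')) ⬝ᵥ ((s - t') + (u - u')) =
              rA j + rB j + (u - u') ⬝ᵥ (u - u') := by
            rw [normsq_add, horth, normsq_sub s t', hA j s hs, hB j t' ht', hAB j s hs t' ht']; ring
          have heq : rA i + rB i = rA j + rB j + (u - u') ⬝ᵥ (u - u') := by
            have := hL; rw [hdec, hR] at this; linarith
          have huu : u - u' ≠ 0 := by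
            intro hz
            have huu' : u = u' := sub_eq_zero.1 hz
            have hrel : t - s' = t' - s := by
              have key : (t' - s) - (t - s') = 0 := by
                rw [← h0, huu', sub_self, add_zero]; abel
              exact (sub_eq_zero.1 key).symm
            exact hij (r2 i j s' hs' t ht s hs t' ht' hrel).1
          have h1 := one_le_dp_self_of_ne_zero huu
          have hw := hE i j (by omega)
          omega
        · by_cases hik : i = k
          · subst hik
            -- pattern (i, j, i), i ≠ j :  rF j − rF i = ‖s − s'‖²
            have hdec : t' - u = (t - u') + (s - s') := by
              have key : (t' - u) - ((t - u') + (s - s')) = 0 := by rw [← h0]; abel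
              exact sub_eq_zero.1 key
            have horth : (t - u') ⬝ᵥ (s - s') = 0 := by
              rw [sub_dp_sub, dotProduct_comm t s, hAB i s hs t ht, dotProduct_comm t s',
                hAB i s' hs' t ht, dotProduct_comm u' s, hAC i s hs u' hu', dotProduct_comm u' s',
                hAC i s' hs' u' hu']
              ring
            have hL : (t' - u) ⬝ᵥ (t' - u) = rB j + rC j := by
              rw [normsq_sub, hB j t' ht', hC j u hu, hBC j t' ht' u hu]; ring
            have hR : ((t - u') + (s - s')) ⬝ᵥ ((t - u') + (s - s')) =
                rB i + rC i + (s - s') ⬝ᵥ (s - s') := by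
              rw [normsq_add, horth, normsq_sub t u', hB i t ht, hC i u' hu', hBC i t ht u' hu']
              ring
            have heq : rB j + rC j = rB i + rC i + (s - s') ⬝ᵥ (s - s') := by
              have := hL; rw [hdec, hR] at this; linarith
            have hss : s - s' ≠ 0 := by
              intro hz
              have hss' : s = s' := sub_eq_zero.1 hz
              have hrel : t - u' = t' - u := by
                have key : (t' - u) - (t - u') = 0 := by
                  rw [← h0, hss', sub_self, zero_add]; abel
                exact (sub_eq_zero.1 key).symm
              exact hij (r3 i j t ht u' hu' t' ht' u hu hrel).1
            have h1 := one_le_dp_self_of_ne_zero hss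
            have hw := hF i j (by omega)
            omega
          · -- all three labels distinct
            by_cases hw0 : (κ i - κ k) + (μ j - μ k) ≤ 0
            · exact absurd h0 (r4 i j k hij hjk hik hw0 s hs s' hs' t ht t' ht' u hu u' hu')
            · omega

/-! ## Corollary 1: the registered one-parameter stub `stub_gradedFrames` -/

/-- Registered signature of `stub_gradedFrames`, verbatim. -/
def GradedFramesWeightedReg : Prop :=
  ∀ (D L : ℕ) (A B C : Fin L → Finset (Fin D → ℤ)) (d : Fin L → ℤ) (xA xB xC α β γ : ℤ), (0 ≤ α ∧ 0 ≤ γ ∧ 1 ≤ α + γ ∧ α < β ∧ γ < β) → ((∀ i, ∀ x ∈ A i, ∀ y ∈ B i, x ⬝ᵥ y = 0) ∧ (∀ i, ∀ x ∈ A i, ∀ z ∈ C i, x ⬝ᵥ z = 0) ∧ (∀ i, ∀ y ∈ B i, ∀ z ∈ C i, y ⬝ᵥ z = 0)) → ((∀ i, ∀ x ∈ A i, x ⬝ᵥ x = xA + α * d i) ∧ (∀ i, ∀ y ∈ B i, y ⬝ᵥ y = xB - β * d i) ∧ (∀ i, ∀ z ∈ C i, z ⬝ᵥ z = xC + γ *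 d i)) → (IsLabelWeightedSTPP A B C (fun i => -d i) (fun i => -d i) ↔ ((∀ i k, ∀ a ∈ A i, ∀ c ∈ C i, ∀ a' ∈ A k, ∀ c' ∈ C k, c - a = c' - a' → i = k ∧ a = a' ∧ c = c') ∧ (∀ i k, ∀ a ∈ A i, ∀ b ∈ B i, ∀ a' ∈ A k, ∀ b' ∈ B k, b - a = b' - a' → i = k ∧ a = a' ∧ b = b') ∧ (∀ i k, ∀ b ∈ B i, ∀ c ∈ C i, ∀ b' ∈ B k, ∀ c' ∈ C k, b - c = b' - c' → i = k ∧ b = b' ∧ c = c') ∧ (∀ i j k : Fin L, i ≠ j → j ≠ k → i ≠ k → 2 * d k ≤ d i + d j → ∀ s ∈ A k, ∀ s' ∈ A i, ∀ t ∈ B i, ∀ t' ∈ B j, ∀ u ∈ C j, ∀ u' ∈ C k, (s' - s) + (t' - t) + (u' - u) ≠ 0)))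

/-- The registered stub from the general bridge (only `1 ≤ α+γ`, `α < β`, `γ < β` are used). -/
theorem gradedFramesWeighted' : GradedFramesWeightedReg := by
  intro D L A B C d xA xB xC α β γ hsl hfr hsph
  obtain ⟨-, -, hαγ, hαβ, hγβ⟩ := hsl
  have hT : ∀ i k, (xA + α * d i) + (xC + γ * d i) < (xA + α * d k) + (xC + γ * d k) →
      1 ≤ ((-d i) + (-d i)) - ((-d k) + (-d k)) := by
    intro i k h
    have h' : (α + γ) * d i < (α + γ) * d k := by linarith
    have : d i < d k := lt_of_mul_lt_mul_left h' (by omega)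
    omega
  have hE : ∀ i j, (xA + α * d j) + (xB - β * d j) < (xA + α * d i) + (xB - β * d i) →
      1 ≤ (-d i) - (-d j) := by
    intro i j h
    have h' : (β - α) * d i < (β - α) * d j := by linarith
    have : d i < d j := lt_of_mul_lt_mul_left h' (by omega)
    omega
  have hF : ∀ i j, (xB - β * d i) + (xC + γ * d i) < (xB - β * d j) + (xC + γ * d j) →
      1 ≤ (-d j) - (-d i) := by
    intro i j h
    have h' : (β - γ) * d j < (β - γ) * d i := by linarith
    have : d j < d i := lt_of_mul_lt_mul_left h' (by omega)
    omega
  have hgen := generalFramesWeighted D L A B C (fun i => xA + α * d i) (fun i => xB - β * d i)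
    (fun i => xC + γ * d i) (fun i => -d i) (fun i => -d i) hfr hsph hT hE hF
  rw [hgen]
  -- the two restricted distinct clauses coincide: weight ≤ 0 ↔ 2·d k ≤ d i + d j
  constructor
  · rintro ⟨r1, r2, r3, r4⟩
    refine ⟨r1, r2, r3, ?_⟩
    intro i j k hij hjk hik hconv
    exact r4 i j k hij hjk hik (by omega)
  · rintro ⟨r1, r2, r3, r4⟩
    refine ⟨r1, r2, r3, ?_⟩
    intro i j k hij hjk hik hw
    exact r4 i j k hij hjk hik (by omega)

/-! ## Corollary 2: the two-parameter grading for the model slopes `(1, 2, 1)` -/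

/-- **Two-parameter graded frames.**  Radii `(xA + g + h, xB − 2g, xC + g − h)`, potentials `κ = h − g`,
`μ = −g − h`: label-weighted iff packings and the distinct clause on the triples with
`2 g k − g i − g j + (h i − h j) ≤ 0`. [new, elementary] -/
theorem twoParameterFramesWeighted (D L : ℕ) (A B C : Fin L → Finset (Fin D → ℤ)) (g h : Fin L → ℤ)
    (xA xB xC : ℤ)
    (hfr : (∀ i, ∀ x ∈ A i, ∀ y ∈ B i, x ⬝ᵥ y = 0) ∧ (∀ i, ∀ x ∈ A i, ∀ z ∈ C i, x ⬝ᵥ z = 0) ∧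
      (∀ i, ∀ y ∈ B i, ∀ z ∈ C i, y ⬝ᵥ z = 0))
    (hsph : (∀ i, ∀ x ∈ A i, x ⬝ᵥ x = xA + g i + h i) ∧ (∀ i, ∀ y ∈ B i, y ⬝ᵥ y = xB - 2 * g i) ∧
      (∀ i, ∀ z ∈ C i, z ⬝ᵥ z = xC + g i - h i)) :
    (IsLabelWeightedSTPP A B C (fun i => h i - g i) (fun i => -g i - h i) ↔
      ((∀ i k, ∀ a ∈ A i, ∀ c ∈ C i, ∀ a' ∈ A k, ∀ c' ∈ C k, c - a = c' - a' → i = k ∧ a = a' ∧ c = c') ∧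
       (∀ i k, ∀ a ∈ A i, ∀ b ∈ B i, ∀ a' ∈ A k, ∀ b' ∈ B k, b - a = b' - a' → i = k ∧ a = a' ∧ b = b') ∧
       (∀ i k, ∀ b ∈ B i, ∀ c ∈ C i, ∀ b' ∈ B k, ∀ c' ∈ C k, b - c = b' - c' → i = k ∧ b = b' ∧ c = c') ∧
       (∀ i j k : Fin L, i ≠ j → j ≠ k → i ≠ k → 2 * g k - g i - g j + (h i - h j) ≤ 0 →
          ∀ s ∈ A k, ∀ s' ∈ A i, ∀ t ∈ B i, ∀ t' ∈ B j, ∀ u ∈ C j, ∀ u' ∈ C k,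
            (s' - s) + (t' - t) + (u' - u) ≠ 0))) := by
  have hT : ∀ i k, (xA + g i + h i) + (xC + g i - h i) < (xA + g k + h k) + (xC + g k - h k) →
      1 ≤ ((h i - g i) + (-g i - h i)) - ((h k - g k) + (-g k - h k)) := by
    intro i k hh; omega
  have hE : ∀ i j, (xA + g j + h j) + (xB - 2 * g j) < (xA + g i + h i) + (xB - 2 * g i) →
      1 ≤ (h i - g i) - (h j - g j) := by
    intro i j hh; omega
  have hF : ∀ i j, (xB - 2 * g i) + (xC + g i - h i) < (xB - 2 * g j) + (xC + g j - h j) →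
      1 ≤ (-g j - h j) - (-g i - h i) := by
    intro i j hh; omega
  have hgen := generalFramesWeighted D L A B C (fun i => xA + g i + h i) (fun i => xB - 2 * g i)
    (fun i => xC + g i - h i) (fun i => h i - g i) (fun i => -g i - h i) hfr hsph hT hE hF
  rw [hgen]
  constructor
  · rintro ⟨r1, r2, r3, r4⟩
    refine ⟨r1, r2, r3, ?_⟩
    intro i j k hij hjk hik hconv
    exact r4 i j k hij hjk hik (by omega)
  · rintro ⟨r1, r2, r3, r4⟩
    refine ⟨r1, r2, r3, ?_⟩
    intro i j k hij hjk hik hw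
    exact r4 i j k hij hjk hik (by omega)

end Summit.MatrixMultiplication.MatrixMultiplication.Cruxes.ThinPackings.DrefuteGeneral
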